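import Mathlib
import Literature.Computability.AlgebraicComplexity.ApolarityAction
import Literature.Computability.AlgebraicComplexity.LinSubst
import Literature.Computability.Complexity.OccurrenceObstructionsBIP
import Summits.ValiantsHypothesis.ValiantsHypothesis.Theorems.ValuativeGCTValuativeFlipCatalecticant
import Summits.ValiantsHypothesis.ValiantsHypothesis.Theorems.ValuativeGCTValuativeFlipCatalecticantShapes

/-!
# Padding kills the low-order corner minors of the catalecticant on `End · (X₀₀^{m-n} per_n)`

Crux `ValuativeGCT.ValuativeFlip` (stmt-ValiantsHypothesis-12624), wall-breaker axis
"explicit padded-permanent highest-weight vectors for seedRichness" (k5 gen 1, seat 3), part 2.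

The corner minors `catMinor a b i₁ i₂ e` (rows: monomial operators `∂^ρ` of degree `a` on the
final segment of `i₁`; columns: monomials `X^γ` of degree `b` on the final segment `V₂` of `i₂`)
are explicit highest-weight vectors of growing length (seat 2), and their weights pass the
Kadish–Landsberg filter only when the SHORT segment has `≤ m/(m-n)` variables
(`catWeight_paddedPer_filter`, part 1).  This file proves that for the padded permanent the
filter is far from sufficient: **whenever the row degree is below the padding, `a < m - n`, and
the column segment has at least two variables, the corner minor vanishes at EVERY point
`A · (X₀₀^{m-n} per_n)`, `A ∈ End(ℂ^{m×m})`** (`det_catMinorMat_paddedPer_eq_zero`, registered stub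
`catMinor_paddedPer_vanishing`).  Example: `a = 1`, rows = the last matrix row (`m` variables),
columns = binary forms of degree `m-1` in the last two variables: the shape
`(1+C(m,2), 1+C(m,2), 1^{m-2}) ⊢ m·m` of LENGTH `m` is Kadish–Landsberg-admissible for every
`m ≤ 2n-1`, yet its corner minor is `≡ 0` on `End · pp` for every `m ≥ n+2`.

Mechanism (elementary, for any `h = ℓ^p · g` with `ℓ` a linear form, any commutative ring for
the divisibility and any field for the rank count):
* `pow_pred_dvd_pderiv`, `pow_sub_degree_dvd_apolarAction_monomial`: `ℓ^p ∣ h ⇒ ℓ^{p-|ρ|} ∣ ∂^ρ h`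
  (Leibniz);
* `coeff_mul_monomial_one_eq_zero`: `coeff_γ(L · X^ν) = 0` unless `ν ≤ γ` and `|ν| + j = |γ|`
  (`L` homogeneous of degree `j`), so the row `γ ↦ coeff_γ(∂^ρ h) = coeff_γ(ℓ^j q_ρ)`, `j = p - a ≥ 1`,
  is a combination of the `#UpIdx σ (b-j) i₂` FIXED vectors `γ ↦ coeff_γ(ℓ^j X^ν)`
  (`coeffVec_mul_eq_sum`);
* `card_upIdx_lt_of_lt`: `#UpIdx σ (b-j) i₂ < #UpIdx σ b i₂ = D` for `j ≥ 1` once the segment has two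
  variables; `D` rows in a space of dimension `< D` are dependent (`det_catMinorMat_eq_zero_of_pow_dvd`).
So for the padded permanent only corners with `min(a, b) ≥ m - n` (or a one-variable segment, i.e.
the coordinate `X_top^m`) can carry a certificate — with part 1, in the tail both segments are then
short: the catalecticant family is not a source of growing-length per-side certificates there
(Cruxes/ValuativeFlip/AxisK5G1S3CatalecticantShapes.md).
[Iarrobino–Kanev LNM 1721 §1.1; Landsberg 2017 §7.2 (degenerate flattenings of padded
polynomials); Efremenko–Landsberg–Schenck–Weyman 2018 (shifted partials vs padding); folklore]
-/

set_option linter.dupNamespace false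

namespace Summit.ValiantsHypothesis.ValiantsHypothesis.Theorems.ValuativeFlip

open MvPolynomial
open scoped BigOperators Matrix
open Literature.Computability.AlgebraicComplexity
open Literature.Computability.Complexity
open Literature.NumberTheory.DiophantineGeometry

noncomputable section

/-! ### Divisibility of derivatives of `ℓ^p · g` -/

section Dvd

variable {σ : Type*} {k : Type*} [CommRing k]

/-- **Leibniz**: if `ℓ^q ∣ f` then `ℓ^{q-1} ∣ ∂_i f`. [folklore] -/
theorem pow_pred_dvd_pderiv {ℓ f : MvPolynomial σ k} {q : ℕ} (h : ℓ ^ q ∣ f) (i : σ) :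
    ℓ ^ (q - 1) ∣ pderiv i f := by
  obtain ⟨g, rfl⟩ := h
  rw [Derivation.leibniz, Derivation.leibniz_pow]
  simp only [smul_eq_mul, nsmul_eq_mul]
  refine dvd_add (Dvd.dvd.mul_right (pow_dvd_pow ℓ (Nat.sub_le q 1)) _) ?_
  exact dvd_mul_of_dvd_right (dvd_mul_of_dvd_right (dvd_mul_right _ _) _) _

/-- Iterated: if `ℓ^q ∣ f` then `ℓ^{q-e} ∣ ∂_i^e f` (`∂_i^e = X_i^e ⌟ ·`). [folklore] -/
theorem pow_sub_dvd_apolarAction_X_pow {ℓ f : MvPolynomial σ k} {q : ℕ} (h : ℓ ^ q ∣ f) (i : σ) (e : ℕ) :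
    ℓ ^ (q - e) ∣ apolarAction (X i ^ e) f := by
  induction e with
  | zero =>
    rw [pow_zero, ← C_1, apolarAction_C, one_smul, Nat.sub_zero]
    exact h
  | succ e ih =>
    rw [pow_succ', apolarAction_mul, apolarAction_X, ← Nat.sub_sub]
    exact pow_pred_dvd_pderiv ih i

/-- **Monomial operators lower the order of vanishing along `ℓ` by their degree**:
if `ℓ^q ∣ f` then `ℓ^{q - |ρ|} ∣ ∂^ρ f`. [folklore] -/
theorem pow_sub_degree_dvd_apolarAction_monomial {ℓ f : MvPolynomial σ k} {q : ℕ} (h : ℓ ^ q ∣ f)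
    (ρ : σ →₀ ℕ) : ℓ ^ (q - ρ.degree) ∣ apolarAction (monomial ρ (1 : k)) f := by
  classical
  induction ρ using Finsupp.induction with
  | zero =>
    rw [map_zero, Nat.sub_zero, ← C_apply, apolarAction_C, one_smul]
    exact h
  | single_add i e ρ' _ _ ih =>
    rw [monomial_single_add, apolarAction_mul, map_add, Finsupp.degree_single, add_comm,
      ← Nat.sub_sub]
    exact pow_sub_dvd_apolarAction_X_pow ih i e

end Dvd

/-! ### Coefficients of `L · X^ν` for a homogeneous `L` -/

section Coeff

variable {σ : Type*} {k : Type*} [CommRing k]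

/-- `coeff_γ (L · X^ν) = 0` unless `ν ≤ γ` and `|ν| + j = |γ|`, for `L` homogeneous of degree `j`.
[folklore] -/
theorem coeff_mul_monomial_one_eq_zero {L : MvPolynomial σ k} {j : ℕ} (hL : L.IsHomogeneous j)
    (ν γ : σ →₀ ℕ) (h : ¬ (ν ≤ γ ∧ ν.degree + j = γ.degree)) : coeff γ (L * monomial ν 1) = 0 := by
  classical
  rw [coeff_mul_monomial']
  split_ifs with hle
  · rw [mul_one]
    apply hL.coeff_eq_zero
    intro hdeg
    apply h
    refine ⟨hle, ?_⟩
    have hγ : γ = ν + (γ - ν) := (add_tsub_cancel_of_le hle).symm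
    rw [hγ, map_add, hdeg]
    -- `(ν + (γ - ν)) - ν`-free form: both sides are `ν.degree + j`
  · rfl

variable [Fintype σ] [LinearOrder σ]

/-- **Row expansion.**  For `L` homogeneous of degree `j` and any `q`, the vector of coefficients of
`L · q` at the degree-`b` monomials of the final segment of `i₂` is a linear combination of the
`#UpIdx σ (b-j) i₂` fixed vectors `γ ↦ coeff_γ (L · X^ν)`, with coefficients `coeff_ν q`. [folklore] -/
theorem coeffVec_mul_eq_sum {L : MvPolynomial σ k} {j : ℕ} (hL : L.IsHomogeneous j) (b : ℕ) (i₂ : σ)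
    (q : MvPolynomial σ k) :
    (fun γ : UpIdx σ b i₂ => coeff γ.vec (L * q)) =
      ∑ ν : UpIdx σ (b - j) i₂, coeff ν.vec q • (fun γ : UpIdx σ b i₂ => coeff γ.vec (L * monomial ν.vec 1)) := by
  classical
  funext γ
  simp only [Finset.sum_apply, Pi.smul_apply, smul_eq_mul]
  -- the common summand
  set F : (σ →₀ ℕ) → k := fun x => coeff x q * coeff γ.vec (L * monomial x 1) with hF
  -- left-hand side as a sum over the support of `q`
  have hl : coeff γ.vec (L * q) = ∑ x ∈ q.support, F x := by
    conv_lhs => rw [q.as_sum, Finset.mul_sum, coeff_sum]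
    refine Finset.sum_congr rfl fun x _ => ?_
    rw [hF]
    simp only
    rw [← mul_one (coeff x q), ← C_mul_monomial, mul_one, mul_left_comm, coeff_C_mul]
  -- right-hand side as a sum over the image `U` of `UpIdx σ (b - j) i₂`
  set U : Finset (σ →₀ ℕ) := Finset.univ.map ⟨UpIdx.vec, UpIdx.vec_injective (b - j) i₂⟩ with hU
  have hr : ∑ ν : UpIdx σ (b - j) i₂, coeff ν.vec q * coeff γ.vec (L * monomial ν.vec 1) = ∑ x ∈ U, F x := by
    rw [hU, Finset.sum_map]
    rfl
  rw [hl, hr]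
  -- both are the sum over `q.support ∪ U`
  have h1 : ∑ x ∈ q.support, F x = ∑ x ∈ q.support ∪ U, F x := by
    refine Finset.sum_subset Finset.subset_union_left fun x _ hx => ?_
    rw [hF]
    simp only
    rw [notMem_support_iff.mp hx, zero_mul]
  have h2 : ∑ x ∈ U, F x = ∑ x ∈ q.support ∪ U, F x := by
    refine Finset.sum_subset Finset.subset_union_right fun x _ hx => ?_
    rw [hF]
    simp only
    rw [coeff_mul_monomial_one_eq_zero hL x γ.vec, mul_zero]
    rintro ⟨hle, hdeg⟩
    apply hx
    rw [hU, Finset.mem_map]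
    have hxdeg : x.degree = b - j := by
      have := degree_upIdx_vec γ
      omega
    have hxsupp : ∀ i ∈ x.support, i₂ ≤ i := fun i hi =>
      γ.supp i (Finsupp.support_mono hle hi)
    exact ⟨⟨⟨x, mem_degMonomials_iff.mpr hxdeg⟩, hxsupp⟩, Finset.mem_univ _, rfl⟩
  rw [h1, h2]

/-- **The number of segment monomials grows strictly with the degree** once the segment has two
variables: `#UpIdx σ c i₂ < #UpIdx σ c' i₂` for `c < c'` (inject by `ν ↦ ν + (c'-c)·e_{i₂}`; the pure
power of another segment variable is missed). [folklore] -/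
theorem card_upIdx_lt_of_lt {c c' : ℕ} (hcc' : c < c') (i₂ : σ) (h2 : 2 ≤ Fintype.card {l : σ // i₂ ≤ l}) :
    Fintype.card (UpIdx σ c i₂) < Fintype.card (UpIdx σ c' i₂) := by
  classical
  -- another segment variable `l ≠ i₂`
  obtain ⟨⟨l, hl⟩, hne⟩ := Fintype.exists_ne_of_one_lt_card h2 ⟨i₂, le_rfl⟩
  have hli : l ≠ i₂ := fun h => hne (Subtype.ext h)
  -- the injection
  let φ : UpIdx σ c i₂ → UpIdx σ c' i₂ := fun ν =>
    ⟨⟨ν.vec + Finsupp.single i₂ (c' - c), mem_degMonomials_iff.mpr (by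
        rw [map_add, Finsupp.degree_single, degree_upIdx_vec]; omega)⟩,
      fun i hi => by
        rcases Finset.mem_union.mp (Finsupp.support_add hi) with h | h
        · exact ν.supp i h
        · rw [Finset.mem_singleton.mp (Finsupp.support_single_subset h)]⟩
  have hφvec : ∀ ν, (φ ν).vec = ν.vec + Finsupp.single i₂ (c' - c) := fun _ => rfl
  have hinj : Function.Injective φ := fun ν ν' h => by
    apply UpIdx.vec_injective
    have h' := congrArg UpIdx.vec h
    rw [hφvec, hφvec] at h'
    exact add_right_cancel h'
  have hns : ¬ Function.Surjective φ := by
    intro hs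
    obtain ⟨ν, hν⟩ := hs ⟨⟨Finsupp.single l c', mem_degMonomials_iff.mpr (Finsupp.degree_single l c')⟩,
      fun i hi => by rw [Finset.mem_singleton.mp (Finsupp.support_single_subset hi)]; exact hl⟩
    have h' := congrArg (fun r : UpIdx σ c' i₂ => r.vec i₂) hν
    simp only [hφvec, Finsupp.add_apply, Finsupp.single_eq_same] at h'
    change ν.vec i₂ + (c' - c) = Finsupp.single l c' i₂ at h'
    rw [Finsupp.single_eq_of_ne hli.symm] at h'
    omega
  exact Fintype.card_lt_of_injective_not_surjective φ hinj hns

end Coeff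

/-! ### The vanishing theorem -/

section Vanishing

variable {σ : Type*} [Fintype σ] [LinearOrder σ] {k : Type*} [Field k]

/-- **Low-order corner minors vanish on forms divisible by a high power of a linear form.**
Let `h = ℓ^p · g` with `ℓ` homogeneous of degree `1`, and consider the corner block of the
catalecticant with rows `∂^ρ`, `|ρ| = a < p`, on the segment of `i₁` and columns `X^γ`, `|γ| = b`, on
the segment `V₂` of `i₂`, `#V₂ ≥ 2`.  Every row `γ ↦ coeff_γ (∂^ρ h)` is the coefficient vector of
`ℓ^{p-a} · q_ρ` and hence lies in the span of the `#UpIdx σ (b-(p-a)) i₂ < #UpIdx σ b i₂ = D` fixed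
vectors `γ ↦ coeff_γ(ℓ^{p-a} X^ν)`; `D` rows in a space of dimension `< D` are dependent, so the
corner minor vanishes.  Landsberg 2017 §7.2 (padded polynomials have degenerate flattenings).
[folklore] -/
theorem det_catMinorMat_eq_zero_of_pow_dvd {ℓ h : MvPolynomial σ k} (hℓ : ℓ.IsHomogeneous 1) {p : ℕ}
    (hh : ℓ ^ p ∣ h) (a b : ℕ) (ha : a < p) (i₁ i₂ : σ) (h2 : 2 ≤ Fintype.card {l : σ // i₂ ≤ l})
    (e : UpIdx σ a i₁ ≃ UpIdx σ b i₂) :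
    (catMinorMat a b i₁ i₂ e h).det = 0 := by
  classical
  set j := p - a with hj
  have hj1 : 1 ≤ j := by omega
  have hL : (ℓ ^ j).IsHomogeneous j := by simpa using hℓ.pow j
  -- each row derivative is `ℓ^j · q_r`
  have hq : ∀ r : UpIdx σ a i₁, ∃ q : MvPolynomial σ k, apolarAction (monomial r.vec (1 : k)) h = ℓ ^ j * q := by
    intro r
    have hd := pow_sub_degree_dvd_apolarAction_monomial hh r.vec
    rwa [degree_upIdx_vec] at hd
  choose q hq using hq
  -- the fixed vectors
  set w : UpIdx σ (b - j) i₂ → (UpIdx σ a i₁ → k) :=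
    fun ν r' => coeff (e r').vec (ℓ ^ j * monomial ν.vec 1) with hw
  set M := catMinorMat a b i₁ i₂ e h with hM
  -- every row of `M` lies in the span of the `w ν`
  have hrow : ∀ r, M r ∈ Submodule.span k (Set.range w) := by
    intro r
    have hfun : M r = ∑ ν : UpIdx σ (b - j) i₂, coeff ν.vec (q r) • w ν := by
      funext r'
      have hexp := congrFun (coeffVec_mul_eq_sum hL b i₂ (q r)) (e r')
      simp only [Finset.sum_apply, Pi.smul_apply, smul_eq_mul] at hexp ⊢
      rw [hM, catMinorMat_apply, catMat_apply, ← hexp]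
      show coeff (e r').vec (apolarAction (monomial r.vec 1) h) = coeff (e r').vec (ℓ ^ j * q r)
      rw [hq r]
    rw [hfun]
    exact Submodule.sum_mem _ fun ν _ => Submodule.smul_mem _ _ (Submodule.subset_span ⟨ν, rfl⟩)
  -- count dimensions
  by_contra hdet
  have hU : IsUnit M := (Matrix.isUnit_iff_isUnit_det M).mpr (isUnit_iff_ne_zero.mpr hdet)
  have hli : LinearIndependent k M.row := Matrix.linearIndependent_rows_iff_isUnit.mpr hU
  have hcard := linearIndependent_iff_card_eq_finrank_span.mp hli
  have hle : Submodule.span k (Set.range M.row) ≤ Submodule.span k (Set.range w) :=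
    Submodule.span_le.mpr (Set.range_subset_iff.mpr fun r => hrow r)
  have h1 : (Set.range M.row).finrank k ≤ (Set.range w).finrank k := Submodule.finrank_mono hle
  have h2' : (Set.range w).finrank k ≤ Fintype.card (UpIdx σ (b - j) i₂) := finrank_range_le_card w
  have h4 : Fintype.card (UpIdx σ a i₁) = Fintype.card (UpIdx σ b i₂) := Fintype.card_congr e
  by_cases hjb : j ≤ b
  · have h3 : Fintype.card (UpIdx σ (b - j) i₂) < Fintype.card (UpIdx σ b i₂) :=
      card_upIdx_lt_of_lt (by omega) i₂ h2
    omega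
  · -- `b < j`: every fixed vector vanishes (no monomial of `ℓ^j X^ν` has degree `b`)
    have hw0 : ∀ ν, w ν = 0 := fun ν => funext fun r' => by
      show coeff (e r').vec (ℓ ^ j * monomial ν.vec 1) = 0
      refine coeff_mul_monomial_one_eq_zero hL _ _ fun hνγ => ?_
      have hb := degree_upIdx_vec (e r')
      omega
    have h5 : (Set.range w).finrank k = 0 := by
      rw [Set.finrank, Submodule.span_eq_bot.mpr, finrank_bot]
      rintro _ ⟨ν, rfl⟩
      exact hw0 ν
    have h6 : 0 < Fintype.card (UpIdx σ a i₁) := card_upIdx_pos a (le_refl i₁)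
    omega

end Vanishing

/-! ### The padded permanent -/

section Padded

/-- **Padding kills the low-order corner minors on `End · (X₀₀^{m-n} per_n)`.**  For row degree
`a < m - n` and a column segment of at least two variables, the corner minor of the catalecticant
vanishes at `A · (X₀₀^{m-n} per_n)` for EVERY matrix `A` (singular allowed): `A · pp = ℓ^{m-n} · (A · per)`
with `ℓ = A · X₀₀` a linear form.  Consequently such corners never certify anything for the padded
permanent, although their weights can pass the Kadish–Landsberg filter (module docstring).
[Landsberg 2017 §7.2; this crux (AxisK5G1S3); folklore] -/
theorem det_catMinorMat_paddedPer_eq_zero (n m a b : ℕ) [NeZero m] (ha : a < m - n) (i₁ i₂ : MatIdx m)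
    (h2 : 2 ≤ Fintype.card {l : MatIdx m // i₂ ≤ l}) (e : UpIdx (MatIdx m) a i₁ ≃ UpIdx (MatIdx m) b i₂)
    (A : Matrix (MatIdx m) (MatIdx m) ℂ) :
    (catMinorMat a b i₁ i₂ e (linSubst (MatIdx m) ℂ A (paddedPerFormLex ℂ n m))).det = 0 := by
  rw [paddedPerFormLex_eq, map_mul, map_pow]
  refine det_catMinorMat_eq_zero_of_pow_dvd ?_ (dvd_mul_right _ _) a b ha i₁ i₂ h2 e
  rw [linSubst_X]
  exact IsHomogeneous.sum _ _ _ fun l _ => by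
    rw [smul_eq_C_mul]; exact (isHomogeneous_X ℂ l).C_mul _

/-- **Registered form** (stub `catMinor_paddedPer_vanishing` of stmt-ValiantsHypothesis-12624, one-line
`∀` signature). [this crux; folklore] -/
theorem catMinor_paddedPer_vanishing :
    ∀ (n m a b : ℕ) [NeZero m], a < m - n → ∀ (i₁ i₂ : MatIdx m), 2 ≤ Fintype.card {l : MatIdx m // i₂ ≤ l} → ∀ (e : UpIdx (MatIdx m) a i₁ ≃ UpIdx (MatIdx m) b i₂) (A : Matrix (MatIdx m) (MatIdx m) ℂ), (catMinorMat a b i₁ i₂ e (linSubst (MatIdx m) ℂ A (paddedPerFormLex ℂ n m))).det = 0 :=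
  fun n m a b _ ha i₁ i₂ h2 e A => det_catMinorMat_paddedPer_eq_zero n m a b ha i₁ i₂ h2 e A

/-- **The evaluation certificate of such a corner is identically zero**: in the language of the
per-side engine, `F(A · pp) = 0` for `F = catMinor a b i₁ i₂ e`, every `A`. [this crux; folklore] -/
theorem aeval_formCoeff_catMinor_paddedPer_eq_zero (n a b : ℕ) [NeZero (a + b)] (ha : a < a + b - n)
    (i₁ i₂ : MatIdx (a + b)) (h2 : 2 ≤ Fintype.card {l : MatIdx (a + b) // i₂ ≤ l})
    (e : UpIdx (MatIdx (a + b)) a i₁ ≃ UpIdx (MatIdx (a + b)) b i₂) (A : Matrix (MatIdx (a + b)) (MatIdx (a + b)) ℂ) :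
    aeval (formCoeff (a + b) (linSubst (MatIdx (a + b)) ℂ A (paddedPerFormLex ℂ n (a + b))))
      (catMinor (k := ℂ) a b i₁ i₂ e) = 0 := by
  rw [aeval_formCoeff_catMinor]
  exact det_catMinorMat_paddedPer_eq_zero n (a + b) a b ha i₁ i₂ h2 e A

end Padded

end

end Summit.ValiantsHypothesis.ValiantsHypothesis.Theorems.ValuativeFlip
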